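import Literature.Probability.RandomPlanarGeometry.HexSAWBrickWallStripFugacityWidthOneTopContactTails
import Literature.Probability.Moments.MGFContinuityTheorem
import HarnessLib

/-!
# The central limit theorem for the number of surface contacts of the width-one strip:
# `(bc − N·b)/√N ⇒ N(0, σ²)` in distribution, `P_{N,y,z}(bc ≤ N b + x√N) → Φ_{σ²}(x)` for every real `x`

Topic `Literature/Probability/RandomPlanarGeometry` (continues `…WidthOneContactGaussianMGF.lean` (★★★ `tendsto_contactMGF_gaussian`:
`E_{N,y,z} e^{s(bc − Nb)/√N} → e^{σ²s²/2}` for EVERY real `s`, `σ² = d/dA b(e^A,z)|_{A = log y} > 0`), `…WidthOneContactGaussianTails.lean`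
(`tendsto_topContactMGF_gaussian`, `deriv_contactB_exp_pos`), `…WidthOneTopContactTails.lean` (the reflection exchanging the walls) and the
Moments file `Literature/Probability/Moments/MGFContinuityTheorem.lean` (★★★ CURTISS' CONTINUITY THEOREM `tendsto_gaussianReal_of_tendsto_mgf`:
mgf convergence on a neighbourhood of `0` to `e^{ms + vs²/2}` ⟹ weak convergence to `N(m,v)`, via the tree's moment theorem of Curtiss and the
method of moments / Lévy's theorem)).  THIS FILE closes the contact programme's limit law: the Gaussian mgf asymptotics become the CENTRAL LIMIT
THEOREM proper — weak convergence of the laws and convergence of the distribution functions at every point.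

* §1 FINITELY SUPPORTED LAWS AS MEASURES (plumbing): `finLaw S w X = Σ_{q∈S} w(q)·δ_{X(q)}` on `ℝ`; `finLaw_apply` / `finLaw_real_apply`
  (`finLaw S w X (A) = Σ_{q ∈ S, X q ∈ A} w q`), `integral_finLaw` (`∫ f = Σ_q w(q) f(X q)` for EVERY `f : ℝ → ℝ`), `integrable_finLaw`,
  `isProbabilityMeasure_finLaw`.
* §2 THE LAW OF THE CENTRED, `√N`-SCALED CONTACT NUMBER: `contactLaw y z N = law of (bc − N·b(y,z))/√N under P_{N,y,z}` (a probability measure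
  for `y, z > 0`), ★ `integral_exp_mul_contactLaw` (its mgf is EXACTLY the quotient of CAR «GAUSSIAN MGF»:
  `∫ e^{sx} d(contactLaw) = C_{1,N}(y e^{s/√N}, z)/C_{1,N}(y,z) · e^{−s√N b}`), `contactLaw_real_Iic` (its distribution function is the tail
  quotient `P_{N,y,z}(bc ≤ N b + x√N)`), `integral_contactLaw` (test functions).
* §3 ★★★★ THE CENTRAL LIMIT THEOREM: `tendsto_contactLaw` — `law((bc − N b)/√N) ⟶ N(0, σ²)` WEAKLY (`ProbabilityMeasure ℝ`);
  `tendsto_sum_wgt_comp_contacts` (`E_{N,y,z} g((bc − Nb)/√N) → ∫ g dN(0,σ²)` for every bounded continuous `g`); ★★★★ `tendsto_contactCDF`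
  — `P_{N,y,z}(bc ≤ N·b + x√N) → N(0,σ²)(−∞, x]` for EVERY real `x`, and `tendsto_contactCDF'` (the limit as `∫_{(−∞,x]} φ_{0,σ²}`);
  `tendsto_contactCCDF` (`P(bc > N b + x√N) → N(0,σ²)(x, ∞)`).
* §4 THE TOP WALL BY REFLECTION: ★★★ `tendsto_topContactCDF` — `P_{N,y,z}(tc ≤ N·b(z,y) + x√N) → N(0, σ_top²)(−∞, x]`,
  `σ_top² = d/dB b(e^B, y)|_{log z}`, for every real `x`.

Numerics (`clt_check.py`, exact bivariate enumeration, stdlib): `(y,z) = (1,1)`, `σ = 0.374898`: `P_N(bc ≤ Nb + x√N)` at `x = −0.5, 0, 0.5` and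
`N = 50, 100, 200, 400`: `0.0521, 0.0709, 0.0930, 0.0877 → Φ(x/σ) = 0.0912`; `0.5116, 0.4775, 0.5164, 0.5037 → 0.5000`; `0.8717, 0.8938, 0.9086,
0.9067 → 0.9088`; Kolmogorov distance at `N = 400`: `0.0196` (half a lattice jump `1/(σ√(2πN)) ≈ 0.053`, as it must be for an integer statistic).
`(2,1)`, `σ = 0.431210`: `x = 0.5`: `0.8636, 0.8870, 0.8728, 0.8864 → 0.8769`; distance `0.0223` at `N = 400`.

## Sources
J. H. Curtiss, Ann. Math. Statist. 13 (1942) 430–433, Theorem 3 (mgf convergence ⟹ convergence in distribution); R. Durrett, *Probability: Theory and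
Examples* (5th ed., 2019) §3.2 (weak convergence of distribution functions, Theorem 3.2.9, Theorem 3.2.11 (iv)); A. Dembo, O. Zeitouni (2010) §2.3 (lane
statements); N. R. Beaton, M. Bousquet-Mélou, J. de Gier, H. Duminil-Copin, A. J. Guttmann, CMP 326 (2014), arXiv:1109.0358v5 §3.2 Proposition 6 (p. 10:
the weights `y^{bc} z^{tc}`, the symmetry of the walls); E. J. Janse van Rensburg, *The Statistical Mechanics of Interacting Walks…* (2000) §3.3 (adsorption
models: fluctuations of the energy).  Nothing is quoted AS PRINTED; the statement is this lineage's.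
-/

noncomputable section

open Filter Topology Finset Set MeasureTheory ProbabilityTheory Literature.Analysis Literature.Probability.Moments
open Literature.Probability.LatticeModels Literature.Probability.Percolation

namespace Literature.Probability.RandomPlanarGeometry.SAW.HexBW

namespace WidthOneYZ

variable {y z : ℝ}

/-! ## §1 Finitely supported laws on `ℝ` as measures (plumbing) -/

/-- The law `Σ_{q ∈ S} w(q)·δ_{X(q)}` of a real statistic `X` under finitely supported nonnegative weights `w` on a finite set `S`, as a
(Mathlib) measure on `ℝ`. [cite: Durrett2019, §3.2 (distribution of a random variable; lane plumbing)] -/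
def finLaw {ι : Type*} (S : Finset ι) (w : ι → ℝ) (X : ι → ℝ) : Measure ℝ :=
  ∑ q ∈ S, ENNReal.ofReal (w q) • Measure.dirac (X q)

open Classical in
/-- `finLaw S w X (A) = Σ_{q ∈ S, X q ∈ A} w q` (as an extended real; `w ≥ 0` on `S`). [cite: Durrett2019, §3.2 (lane plumbing)] -/
theorem finLaw_apply {ι : Type*} (S : Finset ι) {w : ι → ℝ} (X : ι → ℝ) (hw : ∀ q ∈ S, 0 ≤ w q) (A : Set ℝ) :
    finLaw S w X A = ENNReal.ofReal (∑ q ∈ S.filter (fun q => X q ∈ A), w q) := by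
  rw [finLaw, Measure.finsetSum_apply, ENNReal.ofReal_sum_of_nonneg fun q hq => hw q (Finset.mem_filter.1 hq).1, Finset.sum_filter]
  refine Finset.sum_congr rfl fun q _ => ?_
  rw [Measure.smul_apply, Measure.dirac_apply, smul_eq_mul]
  by_cases h : X q ∈ A
  · rw [Set.indicator_of_mem h, Pi.one_apply, mul_one, if_pos h]
  · rw [Set.indicator_of_notMem h, mul_zero, if_neg h]

open Classical in
/-- `finLaw S w X (A) = Σ_{q ∈ S, X q ∈ A} w q` as a real number. [cite: Durrett2019, §3.2 (lane plumbing)] -/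
theorem finLaw_real_apply {ι : Type*} (S : Finset ι) {w : ι → ℝ} (X : ι → ℝ) (hw : ∀ q ∈ S, 0 ≤ w q) (A : Set ℝ) :
    (finLaw S w X).real A = ∑ q ∈ S.filter (fun q => X q ∈ A), w q := by
  rw [measureReal_def, finLaw_apply S X hw A, ENNReal.toReal_ofReal]
  exact Finset.sum_nonneg fun q hq => hw q (Finset.mem_filter.1 hq).1

/-- Every `f : ℝ → ℝ` is integrable against a finitely supported law. [cite: Durrett2019, §3.2 (lane plumbing)] -/
theorem integrable_finLaw {ι : Type*} (S : Finset ι) (w : ι → ℝ) (X : ι → ℝ) (f : ℝ → ℝ) : Integrable f (finLaw S w X) := by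
  rw [finLaw]
  exact integrable_finsetSum_measure.2 fun q _ => (integrable_dirac (by simp)).smul_measure ENNReal.ofReal_ne_top

/-- `∫ f d(finLaw S w X) = Σ_{q ∈ S} w(q) f(X q)` for EVERY `f : ℝ → ℝ` (`w ≥ 0` on `S`). [cite: Durrett2019, §3.2 (lane plumbing)] -/
theorem integral_finLaw {ι : Type*} (S : Finset ι) {w : ι → ℝ} (X : ι → ℝ) (hw : ∀ q ∈ S, 0 ≤ w q) (f : ℝ → ℝ) :
    ∫ x, f x ∂finLaw S w X = ∑ q ∈ S, w q * f (X q) := by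
  rw [finLaw, integral_finsetSum_measure fun q _ => (integrable_dirac (by simp)).smul_measure ENNReal.ofReal_ne_top]
  refine Finset.sum_congr rfl fun q hq => ?_
  rw [integral_smul_measure, integral_dirac, ENNReal.toReal_ofReal (hw q hq), smul_eq_mul]

/-- A finitely supported law with nonnegative weights summing to `1` is a probability measure. [cite: Durrett2019, §3.2 (lane plumbing)] -/
theorem isProbabilityMeasure_finLaw {ι : Type*} (S : Finset ι) {w : ι → ℝ} (X : ι → ℝ) (hw : ∀ q ∈ S, 0 ≤ w q)
    (h1 : ∑ q ∈ S, w q = 1) : IsProbabilityMeasure (finLaw S w X) := by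
  refine ⟨?_⟩
  rw [finLaw, Measure.finsetSum_apply]
  simp only [Measure.smul_apply, measure_univ, smul_eq_mul, mul_one]
  rw [← ENNReal.ofReal_sum_of_nonneg hw, h1, ENNReal.ofReal_one]

/-! ## §2 The law of the centred, `√N`-scaled contact number -/

/-- **The law of `(bc − N·b(y,z))/√N` under `P_{N,y,z}`** (the Boltzmann measure with weights `y^{bc} z^{tc}/C_{1,N}(y,z)` on the walks of
`S_N(S_1)`), as a measure on `ℝ`. [cite: BeatonBousquetMelouDeGierDuminilCopinGuttmann2014, §3.2 (arXiv v5 p. 10: the weights y^{bc} z^{tc}); Durrett2019, §3.2 (lane statement)] -/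
def contactLaw (y z : ℝ) (N : ℕ) : Measure ℝ :=
  finLaw (stripPairs 1 N) (fun q => wgt y z N q / stripZ₂ 1 N y z)
    (fun q => ((bottomVisits₀ q.1 q.2 N : ℝ) - N * contactB y z) / Real.sqrt N)

/-- The Boltzmann weights are nonnegative. [cite: BeatonBousquetMelouDeGierDuminilCopinGuttmann2014, §3.2 (lane plumbing)] -/
theorem wgt_div_nonneg (hy : 0 < y) (hz : 0 < z) (N : ℕ) :
    ∀ q ∈ stripPairs 1 N, 0 ≤ wgt y z N q / stripZ₂ 1 N y z := fun q _ =>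
  div_nonneg (wgt_nonneg hy.le hz.le N q) (stripZ₂_pos 1 N hy hz).le

/-- `contactLaw y z N` is a probability measure for `y, z > 0`. [cite: BeatonBousquetMelouDeGierDuminilCopinGuttmann2014, §3.2 (lane plumbing)] -/
theorem isProbabilityMeasure_contactLaw (hy : 0 < y) (hz : 0 < z) (N : ℕ) : IsProbabilityMeasure (contactLaw y z N) := by
  refine isProbabilityMeasure_finLaw _ _ (wgt_div_nonneg hy hz N) ?_
  rw [← Finset.sum_div, ← stripZ₂_one_eq_sum_wgt, div_self (stripZ₂_pos 1 N hy hz).ne']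

/-- **Test functions**: `∫ g d(contactLaw) = Σ_q (wgt q / C_{1,N}) · g((bc q − N b)/√N) = E_{N,y,z} g((bc − Nb)/√N)`.
[cite: BeatonBousquetMelouDeGierDuminilCopinGuttmann2014, §3.2 (lane plumbing)] -/
theorem integral_contactLaw (hy : 0 < y) (hz : 0 < z) (N : ℕ) (g : ℝ → ℝ) :
    ∫ x, g x ∂contactLaw y z N =
      ∑ q ∈ stripPairs 1 N, wgt y z N q / stripZ₂ 1 N y z * g (((bottomVisits₀ q.1 q.2 N : ℝ) - N * contactB y z) / Real.sqrt N) :=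
  integral_finLaw _ _ (wgt_div_nonneg hy hz N) g

/-- ★ **The mgf of `contactLaw` is the quotient of CAR «GAUSSIAN MGF»**: for every real `s` and every `N`,
`∫ e^{sx} d(contactLaw y z N) = C_{1,N}(y e^{s/√N}, z)/C_{1,N}(y,z) · e^{−s√N·b(y,z)}` (`stripZ₂_one_tilt_eq_sum` with `t = s/√N`, `N/√N = √N`).
[cite: DemboZeitouni2010, §2.2 (exponential tilt; lane statement); BeatonBousquetMelouDeGierDuminilCopinGuttmann2014, §3.2 (arXiv v5 p. 10)] -/
theorem integral_exp_mul_contactLaw (hy : 0 < y) (hz : 0 < z) (N : ℕ) (s : ℝ) :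
    ∫ x, Real.exp (s * x) ∂contactLaw y z N =
      stripZ₂ 1 N (y * Real.exp (s / Real.sqrt N)) z / stripZ₂ 1 N y z * Real.exp (-(s * Real.sqrt N * contactB y z)) := by
  rw [integral_contactLaw hy hz, stripZ₂_one_tilt_eq_sum, Finset.sum_div, Finset.sum_mul]
  refine Finset.sum_congr rfl fun q _ => ?_
  have hsq : (N : ℝ) / Real.sqrt N = Real.sqrt N := Real.div_sqrt
  have hexp : Real.exp (s * (((bottomVisits₀ q.1 q.2 N : ℝ) - N * contactB y z) / Real.sqrt N))
      = Real.exp (s / Real.sqrt N * (bottomVisits₀ q.1 q.2 N : ℝ)) * Real.exp (-(s * Real.sqrt N * contactB y z)) := by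
    rw [← Real.exp_add]
    congr 1
    have e1 : s * (((bottomVisits₀ q.1 q.2 N : ℝ) - N * contactB y z) / Real.sqrt N)
        = s / Real.sqrt N * (bottomVisits₀ q.1 q.2 N : ℝ) - s * contactB y z * ((N : ℝ) / Real.sqrt N) := by ring
    rw [e1, hsq]
    ring
  rw [hexp]
  ring

open Classical in
/-- **The distribution function of `contactLaw` is the tail quotient**: for `N ≥ 1` and every real `x`,
`contactLaw y z N (−∞, x] = Σ_{q : bc(q) ≤ N b + x√N} wgt(q) / C_{1,N}(y,z) = P_{N,y,z}(bc ≤ N·b + x√N)`.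
[cite: Durrett2019, §3.2 (distribution functions; lane plumbing); BeatonBousquetMelouDeGierDuminilCopinGuttmann2014, §3.2] -/
theorem contactLaw_real_Iic (hy : 0 < y) (hz : 0 < z) {N : ℕ} (hN : 1 ≤ N) (x : ℝ) :
    (contactLaw y z N).real (Iic x) =
      (∑ q ∈ (stripPairs 1 N).filter (fun q => (bottomVisits₀ q.1 q.2 N : ℝ) ≤ N * contactB y z + x * Real.sqrt N), wgt y z N q)
        / stripZ₂ 1 N y z := by
  rw [contactLaw, finLaw_real_apply _ _ (wgt_div_nonneg hy hz N), Finset.sum_div]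
  have hsq : 0 < Real.sqrt (N : ℝ) := Real.sqrt_pos.2 (by exact_mod_cast hN)
  refine Finset.sum_congr (Finset.filter_congr fun q _ => ?_) fun _ _ => rfl
  rw [Set.mem_Iic, div_le_iff₀ hsq]
  constructor <;> intro h <;> linarith

/-! ## §3 ★★★★ The central limit theorem for the bottom contacts -/

/-- ★★★★ **THE CENTRAL LIMIT THEOREM FOR THE CONTACT NUMBER, WEAK CONVERGENCE.**  For all `y, z > 0`: the law of `(bc − N·b(y,z))/√N` under
`P_{N,y,z}` converges weakly, as `N → ∞`, to the centred Gaussian `N(0, σ²)` with `σ² = d/dA b(e^A, z)|_{A = log y} > 0` (the variance rate of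
`tendsto_varContacts_div`).  Proof: the mgfs converge on all of `ℝ` (`tendsto_contactMGF_gaussian`, read through `integral_exp_mul_contactLaw`), and Curtiss'
continuity theorem `tendsto_gaussianReal_of_tendsto_mgf` (moments + Lévy) concludes.
[cite: Curtiss1942, Theorem 3; DemboZeitouni2010, §2.3 (lane statement); BeatonBousquetMelouDeGierDuminilCopinGuttmann2014, §3.2 Proposition 6 (arXiv v5 p. 10); JansevanRensburg2000, §3.3 (lane statement)] -/
theorem tendsto_contactLaw (hy : 0 < y) (hz : 0 < z) :
    Tendsto (β := ProbabilityMeasure ℝ) (fun N : ℕ => ⟨contactLaw y z N, isProbabilityMeasure_contactLaw hy hz N⟩) atTop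
      (𝓝 ⟨gaussianReal 0 (deriv (fun A => contactB (Real.exp A) z) (Real.log y)).toNNReal, inferInstance⟩) := by
  set σ2 := deriv (fun A => contactB (Real.exp A) z) (Real.log y) with hσ2
  have hσ : 0 < σ2 := deriv_contactB_exp_pos hy hz
  refine tendsto_gaussianReal_of_tendsto_mgf 0 σ2.toNNReal one_pos (fun s _ N => integrable_finLaw _ _ _ _) fun s _ => ?_
  have h := tendsto_contactMGF_gaussian hy hz s
  rw [show Real.exp (σ2 * s ^ 2 / 2) = Real.exp (0 * s + (σ2.toNNReal : ℝ) * s ^ 2 / 2) by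
    rw [Real.coe_toNNReal _ hσ.le, zero_mul, zero_add]] at h
  refine h.congr fun N => ?_
  rw [ProbabilityMeasure.coe_mk, integral_exp_mul_contactLaw hy hz]

/-- ★★★ **CLT, TEST-FUNCTION FORM**: for every bounded continuous `g : ℝ → ℝ`,
`E_{N,y,z} g((bc − N b)/√N) = Σ_q wgt(q)/C_{1,N} · g((bc q − Nb)/√N) → ∫ g dN(0, σ²)`.
[cite: Curtiss1942, Theorem 3; Durrett2019, §3.2 Theorem 3.2.9 (book p. 123); DemboZeitouni2010, §2.3 (lane statement)] -/
theorem tendsto_sum_wgt_comp_contacts (hy : 0 < y) (hz : 0 < z) (g : BoundedContinuousFunction ℝ ℝ) :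
    Tendsto (fun N : ℕ => ∑ q ∈ stripPairs 1 N,
        wgt y z N q / stripZ₂ 1 N y z * g (((bottomVisits₀ q.1 q.2 N : ℝ) - N * contactB y z) / Real.sqrt N)) atTop
      (𝓝 (∫ x, g x ∂gaussianReal 0 (deriv (fun A => contactB (Real.exp A) z) (Real.log y)).toNNReal)) := by
  have h := (ProbabilityMeasure.tendsto_iff_forall_integral_tendsto.1 (tendsto_contactLaw hy hz)) g
  simp only [ProbabilityMeasure.coe_mk] at h
  refine h.congr fun N => ?_
  exact integral_contactLaw hy hz N g

open Classical in
/-- ★★★★ **THE CENTRAL LIMIT THEOREM FOR THE CONTACT NUMBER, DISTRIBUTION FUNCTIONS.**  For all `y, z > 0` and EVERY real `x`,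
`P_{N,y,z}(bc ≤ N·b(y,z) + x√N) → N(0, σ²)(−∞, x]` as `N → ∞`, `σ² = d/dA b(e^A, z)|_{A = log y}` (the Gaussian has no atoms, so every `x` is a
continuity point).
[cite: Curtiss1942, Theorem 3; Durrett2019, §3.2 (definition of weak convergence, book p. 121) and Theorem 3.2.11 (iv) (p. 124); DemboZeitouni2010, §2.3 (lane statement); BeatonBousquetMelouDeGierDuminilCopinGuttmann2014, §3.2 Proposition 6 (arXiv v5 p. 10)] -/
theorem tendsto_contactCDF (hy : 0 < y) (hz : 0 < z) (x : ℝ) :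
    Tendsto (fun N : ℕ =>
        (∑ q ∈ (stripPairs 1 N).filter (fun q => (bottomVisits₀ q.1 q.2 N : ℝ) ≤ N * contactB y z + x * Real.sqrt N), wgt y z N q)
          / stripZ₂ 1 N y z) atTop
      (𝓝 ((gaussianReal 0 (deriv (fun A => contactB (Real.exp A) z) (Real.log y)).toNNReal).real (Iic x))) := by
  have hσ : 0 < deriv (fun A => contactB (Real.exp A) z) (Real.log y) := deriv_contactB_exp_pos hy hz
  have hv : (deriv (fun A => contactB (Real.exp A) z) (Real.log y)).toNNReal ≠ 0 := by
    rw [ne_eq, Real.toNNReal_eq_zero, not_le]; exact hσ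
  have h := @tendsto_measureReal_Iic_of_tendsto _
    ⟨gaussianReal 0 (deriv (fun A => contactB (Real.exp A) z) (Real.log y)).toNNReal, inferInstance⟩
    (nullSingletonClass_gaussianReal hv) (tendsto_contactLaw hy hz) x
  simp only [ProbabilityMeasure.coe_mk] at h
  refine h.congr' ?_
  filter_upwards [eventually_ge_atTop 1] with N hN
  exact contactLaw_real_Iic hy hz hN x

open Classical in
/-- ★★★★ **CLT, DISTRIBUTION FUNCTIONS, WITH THE GAUSSIAN INTEGRAL DISPLAYED**: for all `y, z > 0` and every real `x`,
`P_{N,y,z}(bc ≤ N·b + x√N) → ∫_{(−∞, x]} φ_{0,σ²}(t) dt = Φ(x/σ)` (`φ_{0,σ²}` = Mathlib's `gaussianPDFReal 0 σ²`).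
[cite: Curtiss1942, Theorem 3; Durrett2019, §3.1 (Gaussian density) and §3.2 Theorem 3.2.11 (iv) (book p. 124); DemboZeitouni2010, §2.3 (lane statement)] -/
theorem tendsto_contactCDF' (hy : 0 < y) (hz : 0 < z) (x : ℝ) :
    Tendsto (fun N : ℕ =>
        (∑ q ∈ (stripPairs 1 N).filter (fun q => (bottomVisits₀ q.1 q.2 N : ℝ) ≤ N * contactB y z + x * Real.sqrt N), wgt y z N q)
          / stripZ₂ 1 N y z) atTop
      (𝓝 (∫ t in Iic x, gaussianPDFReal 0 (deriv (fun A => contactB (Real.exp A) z) (Real.log y)).toNNReal t)) := by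
  have hσ : 0 < deriv (fun A => contactB (Real.exp A) z) (Real.log y) := deriv_contactB_exp_pos hy hz
  have hv : (deriv (fun A => contactB (Real.exp A) z) (Real.log y)).toNNReal ≠ 0 := by
    rw [ne_eq, Real.toNNReal_eq_zero, not_le]; exact hσ
  have hI : (gaussianReal 0 (deriv (fun A => contactB (Real.exp A) z) (Real.log y)).toNNReal).real (Iic x)
      = ∫ t in Iic x, gaussianPDFReal 0 (deriv (fun A => contactB (Real.exp A) z) (Real.log y)).toNNReal t := by
    rw [measureReal_def, gaussianReal_apply_eq_integral 0 hv, ENNReal.toReal_ofReal]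
    exact setIntegral_nonneg measurableSet_Iic fun t _ => gaussianPDFReal_nonneg _ _ t
  rw [← hI]
  exact tendsto_contactCDF hy hz x

open Classical in
/-- ★★★ **CLT, UPPER TAILS**: for all `y, z > 0` and every real `x`, `P_{N,y,z}(bc > N·b + x√N) → N(0, σ²)(x, ∞) = 1 − Φ(x/σ)`.
[cite: Curtiss1942, Theorem 3; Durrett2019, §3.2 Theorem 3.2.11 (iv) (book p. 124); DemboZeitouni2010, §2.3 (lane statement)] -/
theorem tendsto_contactCCDF (hy : 0 < y) (hz : 0 < z) (x : ℝ) :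
    Tendsto (fun N : ℕ =>
        (∑ q ∈ (stripPairs 1 N).filter (fun q => N * contactB y z + x * Real.sqrt N < (bottomVisits₀ q.1 q.2 N : ℝ)), wgt y z N q)
          / stripZ₂ 1 N y z) atTop
      (𝓝 (1 - (gaussianReal 0 (deriv (fun A => contactB (Real.exp A) z) (Real.log y)).toNNReal).real (Iic x))) := by
  have h := (tendsto_contactCDF hy hz x).const_sub 1
  refine h.congr fun N => ?_
  have hZ := stripZ₂_pos 1 N hy hz
  rw [sub_eq_iff_eq_add, ← add_div, eq_div_iff hZ.ne', one_mul, stripZ₂_one_eq_sum_wgt,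
    ← Finset.sum_filter_add_sum_filter_not (stripPairs 1 N)
      (fun q => N * contactB y z + x * Real.sqrt N < (bottomVisits₀ q.1 q.2 N : ℝ)) (wgt y z N)]
  congr 1
  exact Finset.sum_congr (Finset.filter_congr fun q _ => not_lt) fun _ _ => rfl

/-! ## §4 The top wall by reflection -/

open Classical in
/-- ★★★ **THE CENTRAL LIMIT THEOREM FOR THE TOP CONTACTS** (reflection of `tendsto_contactCDF`): for all `y, z > 0` and every real `x`,
`P_{N,y,z}(tc ≤ N·b(z,y) + x√N) → N(0, σ_top²)(−∞, x]`, `σ_top² = d/dB b(e^B, y)|_{B = log z}` (the top wall's variance rate of `tendsto_varTopContacts_div`).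
[cite: Curtiss1942, Theorem 3; BeatonBousquetMelouDeGierDuminilCopinGuttmann2014, §3.2 Proposition 6 (arXiv v5 p. 10: "by the symmetry of bridges, μ_T(y,z) = μ_T(z,y)"); DemboZeitouni2010, §2.3 (lane statement)] -/
theorem tendsto_topContactCDF (hy : 0 < y) (hz : 0 < z) (x : ℝ) :
    Tendsto (fun N : ℕ =>
        (∑ q ∈ (stripPairs 1 N).filter (fun q => (topVisits₀ 1 q.1 q.2 N : ℝ) ≤ N * contactB z y + x * Real.sqrt N), wgt y z N q)
          / stripZ₂ 1 N y z) atTop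
      (𝓝 ((gaussianReal 0 (deriv (fun B => contactB (Real.exp B) y) (Real.log z)).toNNReal).real (Iic x))) := by
  refine (tendsto_contactCDF hz hy x).congr fun N => ?_
  rw [sum_filter_topVisits_eq_sum_filter_bottomVisits y z N (fun k => (k : ℝ) ≤ N * contactB z y + x * Real.sqrt N), stripZ₂_symm 1 N y z]

open Classical in
/-- ★★★ **TOP WALL, WITH THE GAUSSIAN INTEGRAL DISPLAYED**: `P_{N,y,z}(tc ≤ N·b(z,y) + x√N) → ∫_{(−∞, x]} φ_{0,σ_top²}(t) dt` for every real `x`.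
[cite: Curtiss1942, Theorem 3; BeatonBousquetMelouDeGierDuminilCopinGuttmann2014, §3.2 Proposition 6 (arXiv v5 p. 10: symmetry); Durrett2019, §3.2 Theorem 3.2.11 (iv) (book p. 124)] -/
theorem tendsto_topContactCDF' (hy : 0 < y) (hz : 0 < z) (x : ℝ) :
    Tendsto (fun N : ℕ =>
        (∑ q ∈ (stripPairs 1 N).filter (fun q => (topVisits₀ 1 q.1 q.2 N : ℝ) ≤ N * contactB z y + x * Real.sqrt N), wgt y z N q)
          / stripZ₂ 1 N y z) atTop
      (𝓝 (∫ t in Iic x, gaussianPDFReal 0 (deriv (fun B => contactB (Real.exp B) y) (Real.log z)).toNNReal t)) := by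
  refine (tendsto_contactCDF' hz hy x).congr fun N => ?_
  rw [sum_filter_topVisits_eq_sum_filter_bottomVisits y z N (fun k => (k : ℝ) ≤ N * contactB z y + x * Real.sqrt N), stripZ₂_symm 1 N y z]

end WidthOneYZ

end Literature.Probability.RandomPlanarGeometry.SAW.HexBW

end
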